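import Mathlib.Data.Matrix.Mul
import Mathlib.LinearAlgebra.Matrix.NonsingularInverse
import Literature.NumberTheory.Transcendental.PhilipponCriterionProjDist
import HarnessLib

/-!
# Small value estimates at rational translates (Nguyen–Roy 2016) — proofs, VI: distortion of the projective distance under linear maps

Sixth proofs file towards `Literature.NumberTheory.Transcendental.nguyenRoy2016_thm_1` (Nguyen–Roy,
IJNT 12 (2016) = arXiv:1412.5163). **Lemma 5** of the paper states that the translation
`τ(x, y, z) = (x, y + rx, sz)` of `ℙ²(ℂ)` distorts the projective distance by at most a constant
factor per step, `|log dist(τʲα, τʲβ) − log dist(α, β)| ≤ c₁|j|`, because "`τ` and `⋀²τ` are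
invertible linear maps". We PROVE the general statement behind it, for any invertible linear map
of `ℂ^{m+1}` given by a matrix `M` (theorems only, no definitions; `dist` = the tree's
`Nesterenko.projDist`, sup norms throughout):

* `NguyenRoy.norm_mulVec_le` — `‖Mα‖ ≤ (∑_{i,k} |M_{ik}|) ‖α‖`;
* `NguyenRoy.minor_mulVec_eq` — `(Mα)ᵢ(Mβ)ⱼ − (Mα)ⱼ(Mβ)ᵢ = ∑_{k,l} M_{ik}M_{jl}(α_kβ_l − α_lβ_k)`
  (`⋀²M` acts on `α ∧ β`), whence `NguyenRoy.norm_minor_mulVec_le`;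
* `NguyenRoy.projDist_mulVec_le` — **one step**: if `N M = 1` then
  `dist(Mα, Mβ) ≤ (∑|M_{ik}|)² (∑|N_{ik}|)² dist(α, β)`;
* `NguyenRoy.projDist_mulVec_pow_le` — **Lemma 5, upper half**: for invertible `M`,
  `dist(Mʲα, Mʲβ) ≤ cʲ dist(α, β)` with `c = (∑|M_{ik}|)² (∑|M⁻¹_{ik}|)²`;
* `NguyenRoy.projDist_le_mul_projDist_mulVec_pow` — **Lemma 5, lower half**:
  `dist(α, β) ≤ cʲ dist(Mʲα, Mʲβ)` with the same `c`.

## References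

* [NguyenRoy2016] N. A. V. Nguyen, D. Roy, IJNT 12 (2016) = arXiv:1412.5163, §2, Lemma 5 and its
  proof.
-/

noncomputable section

open Matrix Finset
open scoped NNReal
open Literature.NumberTheory.Transcendental.Nesterenko

namespace Literature.NumberTheory.Transcendental

namespace NguyenRoy

variable {m : ℕ}

/-! ### Sup-norm bounds for matrix actions -/

/-- `‖Mα‖ ≤ (∑_{i,k} |M_{ik}|) ‖α‖` for the sup norm on `ℂ^{m+1}`. [folklore] -/
theorem norm_mulVec_le (M : Matrix (Fin (m + 1)) (Fin (m + 1)) ℂ) (α : Fin (m + 1) → ℂ) :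
    ‖M *ᵥ α‖ ≤ (∑ i, ∑ k, ‖M i k‖) * ‖α‖ := by
  refine (pi_norm_le_iff_of_nonneg (by positivity)).mpr fun i => ?_
  rw [mulVec, dotProduct]
  calc ‖∑ k, M i k * α k‖ ≤ ∑ k, ‖M i k‖ * ‖α‖ := by
        refine (norm_sum_le _ _).trans (sum_le_sum fun k _ => ?_)
        rw [norm_mul]
        exact mul_le_mul_of_nonneg_left (norm_le_pi_norm α k) (norm_nonneg _)
    _ = (∑ k, ‖M i k‖) * ‖α‖ := (sum_mul _ _ _).symm
    _ ≤ (∑ i, ∑ k, ‖M i k‖) * ‖α‖ :=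
        mul_le_mul_of_nonneg_right (single_le_sum (f := fun i => ∑ k, ‖M i k‖)
          (fun _ _ => by positivity) (mem_univ i)) (norm_nonneg _)

/-- **`⋀²M` acts on `α ∧ β`**: `(Mα)ᵢ(Mβ)ⱼ − (Mα)ⱼ(Mβ)ᵢ = ∑_{k,l} M_{ik} M_{jl} (α_kβ_l − α_lβ_k)`.
[cite: NguyenRoy2016, Lemma 5 (proof, "τ and ⋀²τ are invertible linear maps")] -/
theorem minor_mulVec_eq (M : Matrix (Fin (m + 1)) (Fin (m + 1)) ℂ) (α β : Fin (m + 1) → ℂ)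
    (i j : Fin (m + 1)) :
    (M *ᵥ α) i * (M *ᵥ β) j - (M *ᵥ α) j * (M *ᵥ β) i =
      ∑ k, ∑ l, M i k * M j l * (α k * β l - α l * β k) := by
  simp only [mulVec, dotProduct, Finset.sum_mul_sum, mul_sub, Finset.sum_sub_distrib]
  congr 1
  · exact sum_congr rfl fun k _ => sum_congr rfl fun l _ => by ring
  · -- swap `k ↔ l` in the second double sum
    rw [Finset.sum_comm]
    exact sum_congr rfl fun k _ => sum_congr rfl fun l _ => by ring

/-- **Minors of `(Mα, Mβ)`**: each is at most `(∑|M_{ik}|)² · δ` when all minors of `(α, β)` are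
`≤ δ`. [cite: NguyenRoy2016, Lemma 5 (proof)] -/
theorem norm_minor_mulVec_le (M : Matrix (Fin (m + 1)) (Fin (m + 1)) ℂ) (α β : Fin (m + 1) → ℂ)
    {δ : ℝ} (hδ0 : 0 ≤ δ) (hδ : ∀ k l, ‖α k * β l - α l * β k‖ ≤ δ) (i j : Fin (m + 1)) :
    ‖(M *ᵥ α) i * (M *ᵥ β) j - (M *ᵥ α) j * (M *ᵥ β) i‖ ≤ (∑ i, ∑ k, ‖M i k‖) ^ 2 * δ := by
  set R := ∑ i, ∑ k, ‖M i k‖ with hR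
  have hRi : ∀ i, ∑ k, ‖M i k‖ ≤ R := fun i =>
    single_le_sum (f := fun i => ∑ k, ‖M i k‖) (fun _ _ => by positivity) (mem_univ i)
  rw [minor_mulVec_eq]
  calc ‖∑ k, ∑ l, M i k * M j l * (α k * β l - α l * β k)‖
      ≤ ∑ k, ∑ l, ‖M i k‖ * ‖M j l‖ * δ := by
        refine (norm_sum_le _ _).trans (sum_le_sum fun k _ => ?_)
        refine (norm_sum_le _ _).trans (sum_le_sum fun l _ => ?_)
        rw [norm_mul, norm_mul]
        gcongr
        exact hδ k l
    _ = (∑ k, ‖M i k‖) * (∑ l, ‖M j l‖) * δ := by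
        rw [sum_mul_sum, sum_mul]
        refine sum_congr rfl fun k _ => ?_
        rw [sum_mul]
    _ ≤ R * R * δ := by gcongr <;> first | positivity | exact hRi _
    _ = R ^ 2 * δ := by ring

/-! ### Distortion of the projective distance -/

/-- **One step.** If `N M = 1` then for non-zero `α, β`:
`dist(Mα, Mβ) ≤ (∑|M_{ik}|)² (∑|N_{ik}|)² dist(α, β)` (`dist = Nesterenko.projDist`).
[cite: NguyenRoy2016, Lemma 5 (proof)] -/
theorem projDist_mulVec_le (M N : Matrix (Fin (m + 1)) (Fin (m + 1)) ℂ) (hNM : N * M = 1)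
    {α β : Fin (m + 1) → ℂ} (hα : α ≠ 0) (hβ : β ≠ 0) :
    projDist (M *ᵥ α) (M *ᵥ β) ≤
      (∑ i, ∑ k, ‖M i k‖) ^ 2 * (∑ i, ∑ k, ‖N i k‖) ^ 2 * projDist α β := by
  set RM := ∑ i, ∑ k, ‖M i k‖ with hRM
  set RN := ∑ i, ∑ k, ‖N i k‖ with hRN
  have hNMv : ∀ γ : Fin (m + 1) → ℂ, N *ᵥ (M *ᵥ γ) = γ := fun γ => by
    rw [mulVec_mulVec, hNM, one_mulVec]
  -- `‖γ‖ ≤ RN ‖Mγ‖`, in particular `Mγ ≠ 0`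
  have hlow : ∀ γ : Fin (m + 1) → ℂ, ‖γ‖ ≤ RN * ‖M *ᵥ γ‖ := fun γ => by
    conv_lhs => rw [← hNMv γ]
    exact norm_mulVec_le N _
  have hMα : M *ᵥ α ≠ 0 := fun h => hα (by rw [← hNMv α, h, mulVec_zero])
  have hMβ : M *ᵥ β ≠ 0 := fun h => hβ (by rw [← hNMv β, h, mulVec_zero])
  have hnα : 0 < ‖M *ᵥ α‖ := norm_pos_iff.mpr hMα
  have hnβ : 0 < ‖M *ᵥ β‖ := norm_pos_iff.mpr hMβ
  have hdpos : 0 ≤ projDist α β := projDist_nonneg _ _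
  -- numerator
  have hnum : ((univ.sup fun q : SkewIdx m =>
      ‖(M *ᵥ α) q.1.1 * (M *ᵥ β) q.1.2 - (M *ᵥ α) q.1.2 * (M *ᵥ β) q.1.1‖₊ : ℝ≥0) : ℝ) ≤
      RM ^ 2 * (projDist α β * (‖α‖ * ‖β‖)) := by
    refine PhilipponMain.sup_minor_le _ _ (by positivity) fun q => ?_
    refine norm_minor_mulVec_le M α β (by positivity) (fun k l => ?_) q.1.1 q.1.2
    rcases lt_trichotomy k l with h | rfl | h
    · exact PhilipponMain.norm_minor_le_projDist_mul hα hβ ⟨(k, l), h⟩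
    · rw [sub_self, norm_zero]; positivity
    · rw [show α k * β l - α l * β k = -(α l * β k - α k * β l) by ring, norm_neg]
      exact PhilipponMain.norm_minor_le_projDist_mul hα hβ ⟨(l, k), h⟩
  -- assemble: `projDist (Mα) (Mβ) = num / (‖Mα‖ ‖Mβ‖)`
  rw [projDist, div_le_iff₀ (mul_pos hnα hnβ)]
  refine hnum.trans ?_
  have h1 : ‖α‖ * ‖β‖ ≤ RN ^ 2 * (‖M *ᵥ α‖ * ‖M *ᵥ β‖) := by
    calc ‖α‖ * ‖β‖ ≤ (RN * ‖M *ᵥ α‖) * (RN * ‖M *ᵥ β‖) :=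
          mul_le_mul (hlow α) (hlow β) (norm_nonneg _) (by positivity)
      _ = RN ^ 2 * (‖M *ᵥ α‖ * ‖M *ᵥ β‖) := by ring
  calc RM ^ 2 * (projDist α β * (‖α‖ * ‖β‖))
      ≤ RM ^ 2 * (projDist α β * (RN ^ 2 * (‖M *ᵥ α‖ * ‖M *ᵥ β‖))) := by gcongr
    _ = RM ^ 2 * RN ^ 2 * projDist α β * (‖M *ᵥ α‖ * ‖M *ᵥ β‖) := by ring

/-- **Nguyen–Roy 2016, Lemma 5 (upper bound).** For an invertible matrix `M` and non-zero `α, β`,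
`dist(Mʲα, Mʲβ) ≤ cʲ dist(α, β)` with `c = (∑|M_{ik}|)² (∑|M⁻¹_{ik}|)²`; together with the lower
bound below this gives `|log dist(τʲα, τʲβ) − log dist(α, β)| ≤ c₁ j` (`c₁ = log c`) for `τ = M`,
in particular for the paper's `τ(x,y,z) = (x, y + rx, sz)`. [cite: NguyenRoy2016, Lemma 5] -/
theorem projDist_mulVec_pow_le (M : Matrix (Fin (m + 1)) (Fin (m + 1)) ℂ) (hM : IsUnit M.det)
    {α β : Fin (m + 1) → ℂ} (hα : α ≠ 0) (hβ : β ≠ 0) (j : ℕ) :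
    projDist (M ^ j *ᵥ α) (M ^ j *ᵥ β) ≤
      ((∑ i, ∑ k, ‖M i k‖) ^ 2 * (∑ i, ∑ k, ‖M⁻¹ i k‖) ^ 2) ^ j * projDist α β := by
  have hinv : M⁻¹ * M = 1 := nonsing_inv_mul M hM
  have hMu : IsUnit M := (isUnit_iff_isUnit_det M).mpr hM
  have hinj : ∀ n : ℕ, Function.Injective (M ^ n).mulVec := fun n =>
    mulVec_injective_iff_isUnit.mpr (hMu.pow n)
  have hne : ∀ (n : ℕ) {γ : Fin (m + 1) → ℂ}, γ ≠ 0 → M ^ n *ᵥ γ ≠ 0 := fun n γ hγ h =>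
    hγ (hinj n (by rw [h, mulVec_zero]))
  induction j with
  | zero => simp
  | succ j ih =>
    rw [pow_succ', ← mulVec_mulVec, ← mulVec_mulVec]
    calc projDist (M *ᵥ (M ^ j *ᵥ α)) (M *ᵥ (M ^ j *ᵥ β))
        ≤ (∑ i, ∑ k, ‖M i k‖) ^ 2 * (∑ i, ∑ k, ‖M⁻¹ i k‖) ^ 2 *
            projDist (M ^ j *ᵥ α) (M ^ j *ᵥ β) :=
          projDist_mulVec_le M M⁻¹ hinv (hne j hα) (hne j hβ)
      _ ≤ (∑ i, ∑ k, ‖M i k‖) ^ 2 * (∑ i, ∑ k, ‖M⁻¹ i k‖) ^ 2 *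
            (((∑ i, ∑ k, ‖M i k‖) ^ 2 * (∑ i, ∑ k, ‖M⁻¹ i k‖) ^ 2) ^ j * projDist α β) :=
          mul_le_mul_of_nonneg_left ih (by positivity)
      _ = _ := by ring

/-- **Nguyen–Roy 2016, Lemma 5 (lower bound).** For an invertible matrix `M` and non-zero `α, β`,
`dist(α, β) ≤ cʲ dist(Mʲα, Mʲβ)` with `c = (∑|M_{ik}|)² (∑|M⁻¹_{ik}|)²` (apply the upper bound to
`M⁻¹` at the points `Mʲα, Mʲβ`). [cite: NguyenRoy2016, Lemma 5] -/
theorem projDist_le_mul_projDist_mulVec_pow (M : Matrix (Fin (m + 1)) (Fin (m + 1)) ℂ)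
    (hM : IsUnit M.det) {α β : Fin (m + 1) → ℂ} (hα : α ≠ 0) (hβ : β ≠ 0) (j : ℕ) :
    projDist α β ≤ ((∑ i, ∑ k, ‖M i k‖) ^ 2 * (∑ i, ∑ k, ‖M⁻¹ i k‖) ^ 2) ^ j *
      projDist (M ^ j *ᵥ α) (M ^ j *ᵥ β) := by
  have hMu : IsUnit M := (isUnit_iff_isUnit_det M).mpr hM
  have hinj : Function.Injective (M ^ j).mulVec := mulVec_injective_iff_isUnit.mpr (hMu.pow j)
  have hne : ∀ {γ : Fin (m + 1) → ℂ}, γ ≠ 0 → M ^ j *ᵥ γ ≠ 0 := fun {γ} hγ h =>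
    hγ (hinj (by rw [h, mulVec_zero]))
  have hM' : IsUnit M⁻¹.det := isUnit_nonsing_inv_det M hM
  have hcomm : Commute M⁻¹ M := by
    rw [Commute, SemiconjBy, nonsing_inv_mul M hM, mul_nonsing_inv M hM]
  have hback : ∀ γ : Fin (m + 1) → ℂ, M⁻¹ ^ j *ᵥ (M ^ j *ᵥ γ) = γ := fun γ => by
    rw [mulVec_mulVec, ← hcomm.mul_pow, nonsing_inv_mul M hM, one_pow, one_mulVec]
  have h := projDist_mulVec_pow_le M⁻¹ hM' (hne hα) (hne hβ) j
  rw [hback, hback, nonsing_inv_nonsing_inv M hM] at h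
  rwa [mul_comm ((∑ i, ∑ k, ‖M⁻¹ i k‖) ^ 2)] at h

end NguyenRoy

end Literature.NumberTheory.Transcendental
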